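import Mathlib
import HarnessLib
import HarnessLib.Audit
import Summits.ValiantsHypothesis.Statement
import Literature.Computability.AlgebraicComplexity.BurgisserBooleanPartsA3Steps
import Literature.Computability.Complexity.Counting
import Literature.Computability.Complexity.CircuitClasses

/-!
Route: LangWeilTransfer

DORMANT since 2026-09-03T10:19:35Z (reconciler: no traction for 5 d (last activity statement-checked at 2026-08-29T09:20:14Z); parked, not closed — `ledger route dormant route-ValiantsHypothesis-LangWeilTransfer --off` to reactivate) — unstaffed, not closed; items shared with open routes are served there. `ledger route dormant <id> --off` reactivates.

# Route LangWeilTransfer — Lang–Weil instead of Riemann — a tame component of the permanent's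
circuit variety gives GRH-free Boolean transfer; per is hard or Galois-shattered

It suffices to show X = ShatteringExclusion ∧ P^#P ⊄ P/poly (card lang-weil-galois-shattering, spine
and only card).
ShatteringExclusion (SE): for every c there are c', d₀, N such that for n ≥ N, if per_n has a
fan-in-two circuit of size ≤ n^c over ℂ,
then it has one of size ≤ n^c' whose COEFFICIENT VARIETY (constant vectors y making Bürgisser's
integer skeleton compute per_n
identically; `skeleton`, TCS §5 (A3)) has a geometric irreducible component with at most n^d₀ Galois
conjugates — typed without Galois
groups as: some minimal prime 𝔭 of the coefficient ideal over ℚ has ≤ n^d₀ minimal primes above it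
in ℚ̄[Y]. SE is implied by VH
(vacuous antecedent) and is violated only in a "Galois-dark" world where every efficient circuit for
per_n needs constants of degree
n^ω(1) so rigidly that Gal(ℚ̄/ℚ) moves every component off itself. Given SE, THEOREM T (crux
TameTransfer + support ScalarRestriction,
unconditional, GRH-free) turns VP_ℂ = VNP_ℂ into P^#P ⊆ P/poly; so X → VH. The Boolean conjunct is
weaker than NP ⊄ P/poly
(NP ⊆ P^#P, tree `NP_subset_PSharpP_holds`).
Lean: `(∀ c : ℕ, ∃ c' d₀ N : ℕ, ∀ n ≥ N, (∃ P :
Literature.Computability.AlgebraicComplexity.ArithCircuit ℂ (Fin n × Fin n), P.IsFanInTwo ∧ P.size ≤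
n ^ c ∧ P.Computes (Literature.Computability.AlgebraicComplexity.perPoly (Fin n) ℂ)) → ∃ P :
Literature.Computability.AlgebraicComplexity.ArithCircuit ℂ (Fin n × Fin n), P.IsFanInTwo ∧ P.size ≤
n ^ c' ∧ P.Computes (Literature.Computability.AlgebraicComplexity.perPoly (Fin n) ℂ) ∧ ∃ I : Ideal
(MvPolynomial (Fin (4 * P.size + 1)) ℚ), I = Ideal.span (Set.range fun α : (Fin n × Fin n) →₀ ℕ =>
MvPolynomial.map (Int.castRingHom ℚ) (MvPolynomial.coeff α (MvPolynomial.sumAlgEquiv ℤ (Fin n × Fin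
n) (Fin (4 * P.size + 1)) (Literature.Computability.AlgebraicComplexity.skeleton P).eval) -
MvPolynomial.C (MvPolynomial.coeff α (Literature.Computability.AlgebraicComplexity.perPoly (Fin n)
ℤ)))) ∧ ∃ 𝔭 ∈ I.minimalPrimes, 0 < ((Ideal.map (MvPolynomial.map (algebraMap ℚ (AlgebraicClosure
ℚ))) 𝔭).minimalPrimes).ncard ∧ ((Ideal.map (MvPolynomial.map (algebraMap ℚ (AlgebraicClosure ℚ)))
𝔭).minimalPrimes).ncard ≤ n ^ d₀) ∧ ¬ (Literature.Computability.Complexity.PSharpP ⊆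
Literature.Computability.Complexity.PPoly)`

## Assembly
Contrapositive re-assembly of Bürgisser's (A3) pipeline with Thm 4.1 replaced: ¬VH ⇒ VP ℂ = VNP ℂ ⇒
per ∈ VP_ℂ (VNP-completeness/membership of
per, tree) ⇒ fan-in-two circuits P_n of size ≤ n^c (exists_computes_size_eq_complexity) ⇒ SE gives
tame P'_n ⇒ the finite coefficient system
S_n (support of the skeleton's x-coefficients; degree ≤ 2^(3s), weight ≤ 2^(2^(3s)) + 1 by
totalDegree_eval_le_two_pow_size /
weight_eval_le_two_pow_two_pow_size; the ℚ-span equals the ideal of SE) ⇒ TameTransfer with T =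
poly(n) exceeding the bit-size of the
permanents used ⇒ prime p_n, r_n, z_n ∈ GaloisField p_n r_n ⇒ coefficient identities give a size-3s
circuit over GaloisField p_n r_n computing
per_n ⇒ ScalarRestriction ⇒ a ZMod p_n circuit of size poly ⇒ its integer skeleton with advice
constants is simulated by B₂-circuits
(cktSize_testBits_aeval_eval, as in cktSize_permCount / cktSize_testBit_countWitnesses with 2^ℓ
replaced by p_n) ⇒ bit circuits for
every #P function ⇒ P^#P ⊆ P/poly (BitCircuits.PRel_ofFun_subset_PPoly_of_bitCircuits) —
contradiction with SharpPNotPPoly. Small n < N handled by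
trivial circuits.

Rationale: WHY THIS LINE. Bürgisser's transfer VP_ℂ = VNP_ℂ ⇒ NP ⊆ P/poly (Burgisser2000TCS Cor 1.2(1), Thm
4.1) uses GRH exactly once: to find a small prime of
residue degree ONE for the number field of a POINT of the constants variety (degree up to 2^poly;
Rojas arXiv:math/0301111 Thm 2 removes GRH
only at the price of exponential-bit primes). This line replaces the point by a COMPONENT W and the
split prime by ANY good prime: if W has
B = poly(n) conjugates its field of definition has degree B, so every prime above p has residue
degree f' ≤ B; good reduction of an
absolutely irreducible model (Noether forms: Schmidt LNM 536 Ch. V Thm 2A/Cor 2B; effective: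
Kaltofen doi:10.1006/jcss.1995.1023, Ruppert
doi:10.1515/crll.1986.369.167, Zannier doi:10.1007/s000130050041) plus effective Lang–Weil
(doi:10.2307/2372655; Cafure–Matera
doi:10.1016/j.ffa.2005.03.003 Thm 5.2/5.4: q > 2δ⁴ suffices) give a point over F_(p^(f'μ)) with
poly(n) bits, and Weil restriction of
scalars F_(p^r) ↪ M_r(F_p) turns the resulting circuit into an F_p-circuit that the tree's mod-p
Boolean simulation
(cktSize_testBits_aeval_eval, PermanentBitsPPoly) digests. Imported areas: arithmetic geometry over
finite fields (Lang–Weil), effective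
elimination/height theory (Krick–Pardo–Sombra doi:10.1215/s0012-7094-01-10934-4, tree
BurgisserThm45Proofs), Galois descent of components.
What it does that route BoolTransfer does not: it discharges BoolTransfer's rank-2 crux BoolGrhFree
WITHOUT ERH under the new, purely
geometric residual hypothesis SE, and it isolates a clean dichotomy (per hard, or its efficient
circuits Galois-chiral); the char-p twin of
TameTransfer needs no heights at all and bears on BoolTransfer's FpBarCollapse (TCS p.74 open
Problem). Negatives index empty; nothing reused
from prior routes except the Boolean tail.

RANKED CRUXES. #0 Target (target) — X = ShatteringExclusion ∧ ¬(P^#P ⊆ P/poly), as in § Thesis. (why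
it might fail: SE fails in a Galois-dark world (all near-optimal circuits for per_n need
degree-n^ω(1) constants with free Galois action on components); P^#P ⊄ P/poly is a Boolean
summit-strength conjecture (implied by NP ⊄ P/poly), blocked by natural
proofs/relativization/algebrization.) [Burgisser2000TCS, arXiv:math/0301111,
doi:10.1016/j.ffa.2005.03.003, KarpLipton1980, arXiv:2606.25121]
#2 ShatteringExclusion (crux) — ∀ c ∃ c' d₀ N ∀ n ≥ N: if per_n has a fan-in-two ℂ-circuit of size ≤
n^c then it has one of size ≤ n^c' whose coefficient ideal I ⊂ ℚ[Y_0..Y_4s] (generators: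
x-coefficients of the integer skeleton minus those of per_n) has a minimal prime 𝔭 with 0 <
#minprimes(𝔭·ℚ̄[Y]) ≤ n^d₀ (= number of Galois conjugates of a geometric component). Card item H_f,
corrected to be EXISTENTIAL over skeletons (a fixed skeleton can be dark: (∏ᵢ(x−αᵢ))² for α with
group S_D has all components with D! conjugates while m_α(x)² has a tame Horner circuit).
[difficulty: open-problem] (why it might fail: A Galois-dark regime — every size-n^O(1) circuit for
per_n uses constants generating fields of degree n^ω(1) with Gal(ℚ̄/ℚ) acting freely on all
components — cannot currently be excluded even for artificial integer targets; unprovable outright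
without touching VH.) [Burgisser2000TCS, arXiv:2606.25121, doi:10.1006/jcom.1997.0433,
arXiv:math/0301111]
#3 TameTransfer (crux) — THEOREM T (arithmetic core, tree currency of TCS Thm 4.1 but GRH-free):
there is a such that for every integer system S : Fin t → ℤ[Y_1..Y_m] of degree ≤ d and weight ≤ w
whose ideal over ℚ has a minimal prime with ≤ B geometric components above it, there are a prime p >
2^T and r ≥ 1 with p^r ≤ 2^((B+T+m+log d+log log w+log t+2)^a) and a solution of S over GaloisField
p r. Proof plan (support TransferGlue): TameResolution (Kronecker/Krick–Pardo parametrisation of the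
ℚ-component with degree ≤ (d+2)^O(m) and log-height single-exponential, U-leading coefficient an
integer) → GoodReduction (an absolutely irreducible factor over F_(p^f'), f' ≤ B, off ≤ poly(δ, log
H, B) bad primes) → LangWeilBound over F_(p^(f'μ)) avoiding ρ = 0 → clear denominators (only powers
of the integer leading coefficient enter). [deps: LangWeilBound, GoodReduction, TameResolution]
[difficulty: L] (why it might fail: Every bound must stay single-exponential: bad primes for Noether
forms over a degree-B field, denominators of the parametrisation, and the Lang–Weil threshold
p^(f'μ) > 2δ⁴ with δ ≤ d^m; a doubly-exponential leak (e.g. Schmidt's k^(2^k) Noether-form degree)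
breaks the p^r bound.) [Burgisser2000TCS, doi:10.1016/j.ffa.2005.03.003,
doi:10.1215/s0012-7094-01-10934-4, doi:10.1006/jcss.1995.1023, doi:10.1515/crll.1986.369.167,
KrickPardo1996, book:schmidt2004-equations-over-finite-fields-elementary-approach]
#4 UniversalTameness (crux) — Galois-tameness of algebraic computation (structural strengthening of
SE, target-independent): there is e such that every integer polynomial g in n variables computed by
a fan-in-two ℂ-circuit P is also computed by one of size ≤ (|P|+n+2)^e whose coefficient ideal has a
minimal prime with ≤ (|P|+n+2)^e geometric components above it. Implies SE (support UniversalGlue);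
a counterexample ("a provably Galois-dark integer family") would itself be a new kind of lower
bound. [difficulty: open-problem] (why it might fail: Norm-type constructions over S_D-fields give
dark SKELETONS cheaply; a family all of whose small circuits are dark may exist (norm forms N_(K/ℚ)
with non-abelian K, where the companion-matrix detour costs D³), and the uniform exponent e may fail
even if a qualitative form holds.) [Burgisser2000TCS, doi:10.1006/jcom.1997.0433, arXiv:2606.25121]
#9 UniversalGlue (support) — UniversalTameness → ShatteringExclusion (instantiate g = per_n, |P| ≤
n^c; pure bookkeeping of exponents). [difficulty: provable-now] [Burgisser2000TCS]
#9 LangWeilBound (support) — Effective Lang–Weil with avoidance (known theorem, to be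
vendored/proved): there is a such that over every finite field K, an absolutely irreducible Q ∈
K[x_0..x_m] and G with Q ∤ G have a common point Q(x) = 0 ≠ G(x) in K^(m+1) as soon as a(deg Q+1)^a
(deg G+1)^a < |K| (Cafure–Matera Thm 5.2: |N − q^m| ≤ (δ−1)(δ−2)q^(m−1/2) + 5δ^(13/3) q^(m−1);
Schmidt Thm V.5A elementary; common zeros of coprime Q, G ≤ δ·deg G·q^(m−1)). [difficulty: XL]
[doi:10.2307/2372655, doi:10.1016/j.ffa.2005.03.003,
book:schmidt2004-equations-over-finite-fields-elementary-approach]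
#9 GoodReduction (support) — Effective Noether–Ostrowski over the geometric factors (known
ingredients, to be assembled): there is a such that for Q ∈ ℤ[x_0..x_m] irreducible over ℚ with f ≥
#geometric factors, outside a set of ≤ a((f+1)(m+1)(deg Q+1)(log₂ wt Q+1))^a primes p, Q mod p has
an absolutely irreducible factor defined over GaloisField p f' for some 1 ≤ f' ≤ f (reduce a
ℚ̄-factor, defined over a field of degree ≤ f, modulo a prime above p; residue degree ≤ f; bad
primes via Kaltofen's effective Bertini + Ruppert/Gao criterion + norms — NOT via Schmidt's Cor V.2B
bound (4‖f‖)^(k^(2^k)), which is too weak). [difficulty: L]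
[book:schmidt2004-equations-over-finite-fields-elementary-approach, doi:10.1006/jcss.1995.1023,
doi:10.1515/crll.1986.369.167, doi:10.1007/s000130050041]
#9 TameResolution (support) — Kronecker/Krick–Pardo parametrisation of a ℚ-irreducible component
with bounds (known-type theorem; the zero-dimensional case r = 0 is Bürgisser's Thm 4.5, PROVED in
tree, BurgisserThm45Proofs): for S of degree ≤ d, weight ≤ w in m unknowns and any minimal prime 𝔭
of its ℚ-ideal there are r ≤ m, Q ∈ ℤ[T_1..T_r][U] irreducible over ℚ with integer leading
U-coefficient cQ ≠ 0 and positive U-degree, #geometric factors of Q ≤ #geometric components of 𝔭, ρ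
∈ ℤ[T] ∖ 0 and V_j ∈ ℤ[T,U] such that every ℚ̄-zero of Q with ρ ≠ 0 maps by V/ρ into V(S); degrees ≤
(d+2)^(a(m+1)), log₂-weights ≤ (d+2)^(a(m+1))·(log₂ w + log₂ t + 2)^a (Noether position by an
integer linear change, primitive element, arithmetic Bézout for the heights). [difficulty: XL]
[KrickPardo1996, doi:10.1215/s0012-7094-01-10934-4, Burgisser2000TCS, doi:10.24033/asens.2196]
#9 TransferGlue (support) — LangWeilBound → GoodReduction → TameResolution → TameTransfer: pick the
tame 𝔭, resolve, discard the ≤ 2^poly bad primes (content of ρ and cQ, GoodReduction's set), take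
the first good prime p > 2^T, the absolutely irreducible factor Q₁ over F_(p^f') (monic in U up to a
unit since cQ is a unit mod p, hence Q₁ ∤ ρ), apply LangWeilBound over GaloisField p (f'μ) with μ
minimal, and clear denominators (pseudo-division by Q only introduces powers of cQ). Bookkeeping of
the exponent a. [difficulty: M] [Burgisser2000TCS, doi:10.1016/j.ffa.2005.03.003]
#9 ScalarRestriction (support) — Weil restriction of scalars for circuits: a fan-in-two circuit over
GaloisField p r computing (the image of) f ∈ F_p[x] yields a fan-in-two circuit over ZMod p
computing f of size ≤ A(r+1)³(|P|+1) (coordinates in an F_p-basis with e_1 = 1; a product gate costs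
O(r³) via structure constants; the first coordinate of the output is f). [difficulty: provable-now]
[Burgisser2000TCS, GathenGerhard2013]
#9 SharpPNotPPoly (support) — P^#P ⊄ P/poly — the Boolean conjunct; implied by NP ⊄ P/poly
(stmt-PneNP-0260, `NPNotSubsetPPoly`, via `NP_subset_PSharpP_holds`); filed for bookkeeping/dedup
with the PneNP tree, not expected to receive prover time here. [difficulty: open-problem]
[KarpLipton1980, Burgisser2000TCS]

TWO-LAYER PLAN. Foreseen glued splits (none filed now): TameTransfer ⇐ TransferGlue's three inputs
are already items, so its split is
LangWeilBound → GoodReduction → TameResolution → TameTransfer (k = 3). Assembly ⇐ CoefficientSystem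
(SE-ideal = span of a finite skeleton
system with degree/weight bounds) → ModPSimulation (GaloisField-circuit for per_n with poly-bit p ⇒
bit circuits for #P) → Assembly.
LangWeilBound ⇐ WeilCurveBound (Bombieri–Stepanov / Schmidt Ch. III) → BertiniPlanes (Schmidt Thm
V.4C / Kaltofen) → LangWeilBound.
A char-p twin TameTransferCharP (constants variety over F_p, tame Frobenius orbit ⇒ point over
F_(p^(Bμ)); needs LangWeilBound only, no
heights) would pay BoolTransfer's FpBarCollapse under the char-p ShatteringExclusion — candidate
child of TameTransfer or a sibling route.

KILL CRITERIA. Refutation of TameTransfer as stated (a doubly-exponential leak that survives every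
restatement of the exponent envelope) closes the route
`refuted:TameTransfer` unless a restated envelope (e.g. p^r ≤ 2^(2^(o(n)))) still yields a Boolean
consequence. A refutation of ShatteringExclusion
is impossible without deciding VH-type questions, but a refutation of UniversalTameness by an
explicit Galois-dark integer family forces a
pivot: SE must then be argued from the structure of the permanent (symmetries of per_n acting on
components) — re-rank SE below a new crux
"gauge-symmetric components are tame". BoolGrhFree (stmt-ValiantsHypothesis-0345) proved elsewhere
by other means moots TameTransfer's role
for VH but not Theorem T itself; NP ⊆ P/poly or P^#P ⊆ P/poly proved would kill the whole
Boolean-transfer family.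

NOT DECOMPOSED YET. The coefficient-system bookkeeping and the mod-p simulation with advice
constants (children of Assembly); the three classical inputs of
TameTransfer are filed as support statements but their internal structure (Weil bound for curves,
effective Bertini, arithmetic Bézout for
positive-dimensional components, Gelfond factor heights, residue fields ≅ GaloisField) is not; the
char-p twin; the ABP/determinantal
variant (StableIrreducibility of Rep_m(per_n), carried from the retired card
components-not-constants-lang-weil, gives B = 1 but only
quasi-polynomial Boolean bits); Hensel variants (any p, precision > log n!) and the
abelian-constants corollary (= card abelian-constants-linnik).

CHEAPEST FALSIFIER. (1) Bookkeeping audit of Theorem T on the toy systems Y^D − 2, Φ_D(Y), N·Y − 1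
and an absolutely irreducible plane curve of degree d
(done by hand here: residue degree ≤ B, log p ≤ T + O(log log w), Lang–Weil threshold log q = O(log
d) — all inside the envelope).
(2) A refuter's search for a Galois-dark family against UniversalTameness: take g_D =
N_(K/ℚ)((x−α)^N − 1) for K with group S_D and ask
whether every circuit of size ≤ poly(D, log N) has only components with D!-size orbits — the
companion-matrix circuit det((xI−C_α)^N − I)
is tame of size poly(D)·log N, so this candidate FAILS to be dark; a refuter should try to beat the
companion-matrix detour.
(3) Grounder lookup: is "solvability of ℤ-systems over F_(p^r) with r·log p ≤ poly from a component
of small Galois orbit" already in print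
(Koiran 1997 doi:10.1006/jcom.1997.0433 eliminates constants for DECISION problems via generic
points; Rojas 2003/2007)? If yes, TameTransfer
becomes `known` and only SE remains.

NUMBERS. Cafure–Matera 2006 (doi:10.1016/j.ffa.2005.03.003): Thm 5.2 |#H(F_q) − q^(n−1)| ≤
(δ−1)(δ−2)q^(n−3/2) + 5δ^(13/3)q^(n−2); Thm 5.4: q > 2δ⁴ ⇒ an
F_q-zero; Cor 7.4: q > max(2(r+1)δ², 2δ⁴) for varieties. Schmidt LNM 536 (book:schmidt2004…): Thm
V.5A |N − q^(n−1)| ≤ (d−1)(d−2)q^(n−3/2) +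
3dΨq^(n−2), Ψ = 2dk²; Thm V.2A Noether forms of degree ≤ k^(2^k), k = C(n+d−1,n) (too weak for us —
hence Kaltofen/Ruppert); Cor V.2B
Ostrowski. Tree skeleton (exists_skeleton): 3s gates, 4s+1 slots, deg ≤ 2^(3s), weight ≤ 2^(2^(3s)).
Bézout: deg V(S) ≤ d^m. Bürgisser TCS
Thm 4.1: π_S(x) ≥ π(x)/d^O(n) − x^(1/2) log(wx) under GRH; unconditional least split prime N𝔭 ≤
d_L^16 (arXiv:1902.08640) — the exponential
gap this route sidesteps by allowing residue degree ≤ B. Items at open: 12 (3 cruxes).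

DEFINITION REQUESTS. To be filed after open (the statements above inline them): `circuitCoeffIdeal P
g` (ℚ-ideal of x-coefficient identities of `skeleton P`
against a target g; topic Literature/Computability/AlgebraicComplexity) and `geomComponentCount 𝔭 :=
((𝔭.map (MvPolynomial.map (algebraMap ℚ
(AlgebraicClosure ℚ)))).minimalPrimes).ncard` (topic Literature/RingTheory); cite facts wanted:
Cafure–Matera Thm 5.2/5.4, Kaltofen 1995
effective Bertini/Noether forms, Ruppert 1986 reduction criterion, KPS 2001 Cor 2.11 (height of a
variety cut out by given equations).

Novelty: Searches (2026-08-15): `lit search --hybrid "Schmidt equations over finite fields elementary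
approach absolutely irreducible"` (held book found,
Thm V.5A / V.2A / Cor V.2B read from chunks p0099–p0111); `lit read arxiv:math/0405302`
(Cafure–Matera, Thms 5.2, 5.3, 5.4, 7.1, Cor 7.4 read);
`lit search --source crossref` for Kaltofen 1995, KPS 2001, Lang–Weil 1954, Ruppert 1986, Zannier
1997, Koiran 1997 (DOIs confirmed);
`lit search --source zbmath "Valiant hypothesis constants generalized Riemann hypothesis Boolean
collapse"` (1 hit: Burgisser2000TCS);
`lit frontier ValiantsHypothesis --since 2020` (30 rows, none on constant elimination / Boolean
parts / Lang–Weil); `lit bridges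
ValiantsHypothesis --cross any`; `lit galaxy search "Valiant's hypothesis" --star all` (13 rows: BCS
book, STACS 2007, Dual VP classes — no
Lang–Weil), `lit galaxy search "Lang-Weil" --star pdf` (8 rows, none in algebraic complexity), `lit
galaxy search "elimination of constants
algebraic complexity" --star all` (0); arXiv/S2/OpenAlex APIs rate-limited (429) this session — the
card's triage audit already grepped
Burgisser2000TCS in full.
Nearest prior art found: Burgisser2000TCS = paper:doi-10-1016-s0304-3975-99-00183-8 (Thm 4.1/4.5/Cor
4.8: POINT of degree 2^poly, degree-one
prime, GRH; p.74 Problem for infinite fields of positive characteristic open); arXiv:math/0301111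
(Rojas: unconditional but exponential-bit
primes); doi:10.1006/jcom.1997.0433 (Koiran: constant elimination for decision problems vi  [refs: 10.1006/jcom.1997.0433, math/0405302, math/0301111, arxiv:math/0405302, paper:doi-10-1016-s0304-3975-99-00183-8, doi:10.1006/jcom.1997.0433]

Barriers (technique_class: boolean-transfer, constant-elimination, Lang-Weil): - technique_class: boolean-transfer, constant-elimination, Lang-Weil
- Literature.Barriers.ValiantsHypothesis.AlgebraicNaturalProofs: N/A — no distinguisher vanishing on
coefficient vectors of small circuits is used; SE/UniversalTameness speak about the Galois geometry
of circuit varieties, and the hardness is imported from the Boolean side (PneNP catalogue — natural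
proofs, relativization, algebrization — applies THERE, as route BoolTransfer records).
- Literature.Barriers.ValiantsHypothesis.PartialDerivativesDetPerm: N/A — no rank/measure-based
lower bound (likewise FullRankMultilinear, DepthReductionChasm, DepthReductionChasmDepthFour and the
files RankMethods, RankLiftingBarrier, ShiftedPartialDerivatives, UnpaddedShiftedPartials).
- Literature.Barriers.ValiantsHypothesis.FullRankMultilinear: N/A — no multilinear/formula measure.
- Literature.Barriers.ValiantsHypothesis.DepthReductionChasm: N/A — depth reduction is not used for
a lower bound (the skeleton keeps depth; degree 2^(3s) is absorbed by single-exponential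
bookkeeping).
- Literature.Barriers.ValiantsHypothesis.GCTOccurrenceObstructions: N/A — no
representation-theoretic obstructions (likewise GCTUsefulModules, GCTMatrixPowering,
NotViaSaturations, KroneckerPlethysmHardness).
- Literature.Barriers.ValiantsHypothesis.MonotoneGap: N/A — nothing monotone.
- Literature.Barriers.ValiantsHypothesis.NoncommutativeExtensions: N/A — no formula-size or
ring-oblivious argument; TauRealZeros N/A (the τ line is route TauConst)

Novelty grade: new-combination — ROUTE REVIEW (refuter rreview-13955765, 2026-08-15). KEEP OPEN; D-0027 §2.1-conformant (Assembly: SE→TameTransfer→ScalarRestriction→SharpPNotPPoly→ValiantsHypothesis). All 12 decls elaborate (W_VAL.lean rc0). new-combination = {Burgisser TCS2000 Thm4.1/Cor4.8 + Koiran (points, degree-one prime, GRH) (refuter refuter-rreview-route-AtomisticToContinu-13955765-0, 2026-08-15T14:00:04Z; prior: paper:doi-10-1016-s0304-3975-99-00183-8 (Burgisser TCS 2000, Thm 4.1/Cor 4.8), arXiv:math/0301111 (Rojas 2003, Thm 2), doi:10.1016/j.ffa.2005.03.003 (Cafure-Matera 2006, Thm 5.2/5.4), doi:10.1215/s0012-7094-01-10934-4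 (Krick-Pardo-Sombra 2001), doi:10.1006/jcom.1997.0433 (Koiran 1997), doi:10.1515/crll.1986.369.167 (Ruppert 1986), doi:10.1006/jcss.1995.1023 (Kaltofen 1995))

History (route lifecycle, newest last):
- 2026-08-22T15:02:54Z · DORMANT — reconciler: no traction for 5.4 d (last activity item-evidence-added at 2026-08-17T04:13:43Z); parked, not closed — `ledger route dormant route-ValiantsHypothes (operator:999:2171842)
- 2026-08-26T12:43:07Z · REACTIVATED — reconciler: reactivated — activity item-proof-filed at 2026-08-26T11:43:51Z after parking at 2026-08-22T15:02:54Z (operator:999:2744208)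
- 2026-09-03T10:19:35Z · DORMANT — reconciler: no traction for 5 d (last activity statement-checked at 2026-08-29T09:20:14Z); parked, not closed — `ledger route dormant route-ValiantsHypothesis-L (operator:999:381884)

sub-problem: ValiantsHypothesis · status: dormant · opened planner-plancard-ValiantsHypothesis-ValiantsH-249a49d4-0 2026-08-15T11:46:17Z · rev 1 · ledger route-ValiantsHypothesis-LangWeilTransfer
GENERATED by the gate from the ledger (D-0016/17). Provers cite these decls: `theorem foo : Summit.ValiantsHypothesis.ValiantsHypothesis.Theses.LangWeilTransfer.<Decl> := …` in Summits/ValiantsHypothesis/ValiantsHypothesis/Theorems/<Name>.lean.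
-/

namespace Summit.ValiantsHypothesis.ValiantsHypothesis.Theses.LangWeilTransfer

open scoped BigOperators Topology Manifold Classical MeasureTheory ProbabilityTheory Matrix InnerProductSpace ComplexConjugate ContinuousMap
open Filter Set Function TopologicalSpace MeasureTheory

attribute [summit_statement] _root_.ValiantsHypothesis

open Literature.PNP

/-- item stmt-ValiantsHypothesis-6371 · target · rank 0 · open · by planner
why it might fail: SE fails in a Galois-dark world (all near-optimal circuits for per_n need degree-n^ω(1) constants with free Galois action on components); P^#P ⊄ P/poly is a Boolean summit-strength conjecture (implied by NP ⊄ P/poly), blocked by natural proofs/relativization/algebrization.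
sources: Burgisser2000TCS, arXiv:math/0301111, doi:10.1016/j.ffa.2005.03.003, KarpLipton1980, arXiv:2606.25121
[target] X = ShatteringExclusion ∧ ¬(P^#P ⊆ P/poly), as in § Thesis. -/
@[route_item "route-ValiantsHypothesis-LangWeilTransfer"]
def Target : Prop :=
  (∀ c : ℕ, ∃ c' d₀ N : ℕ, ∀ n ≥ N, (∃ P : Literature.Computability.AlgebraicComplexity.ArithCircuit ℂ (Fin n × Fin n), P.IsFanInTwo ∧ P.size ≤ n ^ c ∧ P.Computes (Literature.Computability.AlgebraicComplexity.perPoly (Fin n) ℂ)) → ∃ P : Literature.Computability.AlgebraicComplexity.ArithCircuit ℂ (Fin n × Fin n), P.IsFanInTwo ∧ P.size ≤ n ^ c' ∧ P.Computes (Literature.Computability.AlgebraicComplexity.perPoly (Fin n) ℂ) ∧ ∃ I : Ideal (MvPolynomial (Fin (4 * P.size + 1)) ℚ), I = Ideal.span (Set.range fun α : (Fin n × Fin n) →₀ ℕ => MvPolynomial.map (Int.castRingHom ℚ) (MvPolynomial.coeff α (MvPolynomial.sumAlgEquiv ℤ (Fin n × Fin n) (Fin (4 * P.size + 1)) (Literature.Computability.AlgebraicComplexity.skeleton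 P).eval) - MvPolynomial.C (MvPolynomial.coeff α (Literature.Computability.AlgebraicComplexity.perPoly (Fin n) ℤ)))) ∧ ∃ 𝔭 ∈ I.minimalPrimes, 0 < ((Ideal.map (MvPolynomial.map (algebraMap ℚ (AlgebraicClosure ℚ))) 𝔭).minimalPrimes).ncard ∧ ((Ideal.map (MvPolynomial.map (algebraMap ℚ (AlgebraicClosure ℚ))) 𝔭).minimalPrimes).ncard ≤ n ^ d₀) ∧ ¬ (Literature.Computability.Complexity.PSharpP ⊆ Literature.Computability.Complexity.PPoly)

/-- item stmt-ValiantsHypothesis-6372 · crux · rank 2 · open · by planner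
why it might fail: A Galois-dark regime — every size-n^O(1) circuit for per_n uses constants generating fields of degree n^ω(1) with Gal(ℚ̄/ℚ) acting freely on all components — cannot currently be excluded even for artificial integer targets; unprovable outright without touching VH.
sources: Burgisser2000TCS, arXiv:2606.25121, doi:10.1006/jcom.1997.0433, arXiv:math/0301111
[crux] ∀ c ∃ c' d₀ N ∀ n ≥ N: if per_n has a fan-in-two ℂ-circuit of size ≤ n^c then it has one of
size ≤ n^c' whose coefficient ideal I ⊂ ℚ[Y_0..Y_4s] (generators: x-coefficients of the integer
skeleton minus those of per_n) has a minimal prime 𝔭 with 0 < #minprimes(𝔭·ℚ̄[Y]) ≤ n^d₀ (= number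
of Galois conjugates of a geometric component). Card item H_f, corrected to be EXISTENTIAL over
skeletons (a fixed skeleton can be dark: (∏ᵢ(x−αᵢ))² for α with group S_D has all components with D!
conjugates while m_α(x)² has a tame Horner circuit). [difficulty: open-problem] -/
@[route_item "route-ValiantsHypothesis-LangWeilTransfer"]
def ShatteringExclusion : Prop :=
  ∀ c : ℕ, ∃ c' d₀ N : ℕ, ∀ n ≥ N, (∃ P : Literature.Computability.AlgebraicComplexity.ArithCircuit ℂ (Fin n × Fin n), P.IsFanInTwo ∧ P.size ≤ n ^ c ∧ P.Computes (Literature.Computability.AlgebraicComplexity.perPoly (Fin n) ℂ)) → ∃ P : Literature.Computability.AlgebraicComplexity.ArithCircuit ℂ (Fin n × Fin n), P.IsFanInTwo ∧ P.size ≤ n ^ c' ∧ P.Computes (Literature.Computability.AlgebraicComplexity.perPoly (Fin n) ℂ) ∧ ∃ I : Ideal (MvPolynomial (Fin (4 * P.size + 1)) ℚ), I = Ideal.span (Set.range fun α : (Fin n × Fin n) →₀ ℕ => MvPolynomial.map (Int.castRingHom ℚ) (MvPolynomial.coeff α (MvPolynomial.sumAlgEquiv ℤ (Fin n × Fin n)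 (Fin (4 * P.size + 1)) (Literature.Computability.AlgebraicComplexity.skeleton P).eval) - MvPolynomial.C (MvPolynomial.coeff α (Literature.Computability.AlgebraicComplexity.perPoly (Fin n) ℤ)))) ∧ ∃ 𝔭 ∈ I.minimalPrimes, 0 < ((Ideal.map (MvPolynomial.map (algebraMap ℚ (AlgebraicClosure ℚ))) 𝔭).minimalPrimes).ncard ∧ ((Ideal.map (MvPolynomial.map (algebraMap ℚ (AlgebraicClosure ℚ))) 𝔭).minimalPrimes).ncard ≤ n ^ d₀

/-- item stmt-ValiantsHypothesis-6373 · crux · rank 3 · closed · proved by Summit.ValiantsHypothesis.ValiantsHypothesis.Theorems.LangWeilTransfer.tameTransfer_proof (prover) · by planner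
why it might fail: Every bound must stay single-exponential: bad primes for Noether forms over a degree-B field, denominators of the parametrisation, and the Lang–Weil threshold p^(f'μ) > 2δ⁴ with δ ≤ d^m; a doubly-exponential leak (e.g. Schmidt's k^(2^k) Noether-form degree) breaks the p^r bound.
sources: Burgisser2000TCS, doi:10.1016/j.ffa.2005.03.003, doi:10.1215/s0012-7094-01-10934-4, doi:10.1006/jcss.1995.1023, doi:10.1515/crll.1986.369.167, KrickPardo1996
[crux] THEOREM T (arithmetic core, tree currency of TCS Thm 4.1 but GRH-free): there is a such that
for every integer system S : Fin t → ℤ[Y_1..Y_m] of degree ≤ d and weight ≤ w whose ideal over ℚ has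
a minimal prime with ≤ B geometric components above it, there are a prime p > 2^T and r ≥ 1 with p^r
≤ 2^((B+T+m+log d+log log w+log t+2)^a) and a solution of S over GaloisField p r. Proof plan
(support TransferGlue): TameResolution (Kronecker/Krick–Pardo parametrisation of the ℚ-component
with degree ≤ (d+2)^O(m) and log-height single-exponential, U-leading coefficient an integer) →
GoodReduction (an absolutely irreducible factor over F_(p^f'), f' ≤ B, off ≤ poly(δ, log H, B) bad
primes) → LangWeilBound over F_(p^(f'μ)) avoiding ρ = 0 → clear denominators (only powers of the
integer leading coefficient enter). [deps: LangWeilBound, GoodReduction, TameResolution]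
[difficulty: L] -/
@[route_item "route-ValiantsHypothesis-LangWeilTransfer"]
def TameTransfer : Prop :=
  ∃ a : ℕ, ∀ (m t d w B T : ℕ) (S : Fin t → MvPolynomial (Fin m) ℤ), (∀ i, (S i).totalDegree ≤ d) → (∀ i, Literature.Computability.AlgebraicComplexity.weight (S i) ≤ w) → (∃ 𝔭 ∈ (Ideal.span (Set.range fun i => MvPolynomial.map (Int.castRingHom ℚ) (S i))).minimalPrimes, 0 < ((Ideal.map (MvPolynomial.map (algebraMap ℚ (AlgebraicClosure ℚ))) 𝔭).minimalPrimes).ncard ∧ ((Ideal.map (MvPolynomial.map (algebraMap ℚ (AlgebraicClosure ℚ))) 𝔭).minimalPrimes).ncard ≤ B) → ∃ (p r : ℕ) (_ : Fact p.Prime), 2 ^ T < p ∧ 0 < r ∧ p ^ r ≤ 2 ^ ((B + T + m + Nat.log 2 d + Nat.log 2 (Nat.log 2 w) + Nat.log 2 t + 2) ^ a) ∧ ∃ z : Fin m → GaloisField p r, ∀ i, MvPolynomial.aeval z (S i) = 0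

-- `TameTransfer` holds: proved by `Summit.ValiantsHypothesis.ValiantsHypothesis.Theorems.LangWeilTransfer.tameTransfer_proof` (its module imports this route file, so no `_holds` link can be stated here).

/-- item stmt-ValiantsHypothesis-6374 · crux · rank 4 · open · by planner
why it might fail: Norm-type constructions over S_D-fields give dark SKELETONS cheaply; a family all of whose small circuits are dark may exist (norm forms N_(K/ℚ) with non-abelian K, where the companion-matrix detour costs D³), and the uniform exponent e may fail even if a qualitative form holds.
sources: Burgisser2000TCS, doi:10.1006/jcom.1997.0433, arXiv:2606.25121
[crux] Galois-tameness of algebraic computation (structural strengthening of SE,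
target-independent): there is e such that every integer polynomial g in n variables computed by a
fan-in-two ℂ-circuit P is also computed by one of size ≤ (|P|+n+2)^e whose coefficient ideal has a
minimal prime with ≤ (|P|+n+2)^e geometric components above it. Implies SE (support UniversalGlue);
a counterexample ("a provably Galois-dark integer family") would itself be a new kind of lower
bound. [difficulty: open-problem] -/
@[route_item "route-ValiantsHypothesis-LangWeilTransfer"]
def UniversalTameness : Prop :=
  ∃ e : ℕ, ∀ (n : ℕ) (g : MvPolynomial (Fin n) ℤ) (P : Literature.Computability.AlgebraicComplexity.ArithCircuit ℂ (Fin n)), P.IsFanInTwo → P.Computes (MvPolynomial.map (Int.castRingHom ℂ) g) → ∃ P' : Literature.Computability.AlgebraicComplexity.ArithCircuit ℂ (Fin n), P'.IsFanInTwo ∧ P'.size ≤ (P.size + n + 2) ^ e ∧ P'.Computes (MvPolynomial.map (Int.castRingHom ℂ) g) ∧ ∃ I : Ideal (MvPolynomial (Fin (4 * P'.size + 1)) ℚ), I = Ideal.span (Set.range fun α : Fin n →₀ ℕ => MvPolynomial.map (Int.castRingHom ℚ) (MvPolynomial.coeff α (MvPolynomial.sumAlgEquiv ℤ (Fin n) (Fin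 (4 * P'.size + 1)) (Literature.Computability.AlgebraicComplexity.skeleton P').eval) - MvPolynomial.C (MvPolynomial.coeff α g))) ∧ ∃ 𝔭 ∈ I.minimalPrimes, 0 < ((Ideal.map (MvPolynomial.map (algebraMap ℚ (AlgebraicClosure ℚ))) 𝔭).minimalPrimes).ncard ∧ ((Ideal.map (MvPolynomial.map (algebraMap ℚ (AlgebraicClosure ℚ))) 𝔭).minimalPrimes).ncard ≤ (P.size + n + 2) ^ e

/-- item stmt-ValiantsHypothesis-6375 · support · rank 9 · closed · proved by Summit.ValiantsHypothesis.ValiantsHypothesis.Theorems.LangWeilTransfer.universalGlue_proof (prover) · by planner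
sources: Burgisser2000TCS
[support] UniversalTameness → ShatteringExclusion (instantiate g = per_n, |P| ≤ n^c; pure
bookkeeping of exponents). [difficulty: provable-now] -/
@[route_item "route-ValiantsHypothesis-LangWeilTransfer"]
def UniversalGlue : Prop :=
  UniversalTameness → ShatteringExclusion

-- `UniversalGlue` holds: proved by `Summit.ValiantsHypothesis.ValiantsHypothesis.Theorems.LangWeilTransfer.universalGlue_proof` (its module imports this route file, so no `_holds` link can be stated here).

/-- item stmt-ValiantsHypothesis-6376 · support · rank 9 · closed · proved by Summit.ValiantsHypothesis.ValiantsHypothesis.Theorems.LangWeilTransfer.langWeilBound_proof (prover) · by planner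
sources: doi:10.2307/2372655, doi:10.1016/j.ffa.2005.03.003, book:schmidt2004-equations-over-finite-fields-elementary-approach
[support] Effective Lang–Weil with avoidance (known theorem, to be vendored/proved): there is a such
that over every finite field K, an absolutely irreducible Q ∈ K[x_0..x_m] and G with Q ∤ G have a
common point Q(x) = 0 ≠ G(x) in K^(m+1) as soon as a(deg Q+1)^a (deg G+1)^a < |K| (Cafure–Matera Thm
5.2: |N − q^m| ≤ (δ−1)(δ−2)q^(m−1/2) + 5δ^(13/3) q^(m−1); Schmidt Thm V.5A elementary; common zeros
of coprime Q, G ≤ δ·deg G·q^(m−1)). [difficulty: XL] -/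
@[route_item "route-ValiantsHypothesis-LangWeilTransfer"]
def LangWeilBound : Prop :=
  ∃ a : ℕ, ∀ (K : Type) [Field K] [Fintype K] (m : ℕ) (Q G : MvPolynomial (Fin (m + 1)) K), Irreducible (MvPolynomial.map (algebraMap K (AlgebraicClosure K)) Q) → ¬ (Q ∣ G) → a * (Q.totalDegree + 1) ^ a * (G.totalDegree + 1) ^ a < Fintype.card K → ∃ x : Fin (m + 1) → K, MvPolynomial.aeval x Q = 0 ∧ MvPolynomial.aeval x G ≠ 0

-- `LangWeilBound` holds: proved by `Summit.ValiantsHypothesis.ValiantsHypothesis.Theorems.LangWeilTransfer.langWeilBound_proof` (its module imports this route file, so no `_holds` link can be stated here).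

/-- item stmt-ValiantsHypothesis-6377 · support · rank 9 · closed · proved by Summit.ValiantsHypothesis.ValiantsHypothesis.Theorems.LangWeilTransfer.goodReduction_proof (prover) · by planner
sources: book:schmidt2004-equations-over-finite-fields-elementary-approach, doi:10.1006/jcss.1995.1023, doi:10.1515/crll.1986.369.167, doi:10.1007/s000130050041
[support] Effective Noether–Ostrowski over the geometric factors (known ingredients, to be
assembled): there is a such that for Q ∈ ℤ[x_0..x_m] irreducible over ℚ with f ≥ #geometric factors,
outside a set of ≤ a((f+1)(m+1)(deg Q+1)(log₂ wt Q+1))^a primes p, Q mod p has an absolutely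
irreducible factor defined over GaloisField p f' for some 1 ≤ f' ≤ f (reduce a ℚ̄-factor, defined
over a field of degree ≤ f, modulo a prime above p; residue degree ≤ f; bad primes via Kaltofen's
effective Bertini + Ruppert/Gao criterion + norms — NOT via Schmidt's Cor V.2B bound
(4‖f‖)^(k^(2^k)), which is too weak). [difficulty: L] -/
@[route_item "route-ValiantsHypothesis-LangWeilTransfer"]
def GoodReduction : Prop :=
  ∃ a : ℕ, ∀ (m f : ℕ) (Q : MvPolynomial (Fin (m + 1)) ℤ), Irreducible (MvPolynomial.map (Int.castRingHom ℚ) Q) → 0 < ((Ideal.map (MvPolynomial.map (algebraMap ℚ (AlgebraicClosure ℚ))) (Ideal.span {MvPolynomial.map (Int.castRingHom ℚ) Q})).minimalPrimes).ncard → ((Ideal.map (MvPolynomial.map (algebraMap ℚ (AlgebraicClosure ℚ))) (Ideal.span {MvPolynomial.map (Int.castRingHom ℚ) Q})).minimalPrimes).ncard ≤ f → ∃ bad : Finset ℕ, bad.card ≤ a * ((f + 1) * (m + 1) * (Q.totalDegree + 1) * (Nat.log 2 (Literature.Computability.AlgebraicComplexity.weight Q) + 1)) ^ a ∧ ∀ (p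 : ℕ) [Fact p.Prime], p ∉ bad → ∃ f' : ℕ, 0 < f' ∧ f' ≤ f ∧ ∃ Q₁ : MvPolynomial (Fin (m + 1)) (GaloisField p f'), Irreducible (MvPolynomial.map (algebraMap (GaloisField p f') (AlgebraicClosure (GaloisField p f'))) Q₁) ∧ Q₁ ∣ MvPolynomial.map (algebraMap ℤ (GaloisField p f')) Q

-- `GoodReduction` holds: proved by `Summit.ValiantsHypothesis.ValiantsHypothesis.Theorems.LangWeilTransfer.goodReduction_proof` (its module imports this route file, so no `_holds` link can be stated here).

/-- item stmt-ValiantsHypothesis-6378 · support · rank 9 · closed · proved by Summit.ValiantsHypothesis.ValiantsHypothesis.Theorems.LangWeilTransfer.tameResolution_proof (prover) · by planner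
sources: KrickPardo1996, doi:10.1215/s0012-7094-01-10934-4, Burgisser2000TCS, doi:10.24033/asens.2196
[support] Kronecker/Krick–Pardo parametrisation of a ℚ-irreducible component with bounds (known-type
theorem; the zero-dimensional case r = 0 is Bürgisser's Thm 4.5, PROVED in tree,
BurgisserThm45Proofs): for S of degree ≤ d, weight ≤ w in m unknowns and any minimal prime 𝔭 of its
ℚ-ideal there are r ≤ m, Q ∈ ℤ[T_1..T_r][U] irreducible over ℚ with integer leading U-coefficient cQ
≠ 0 and positive U-degree, #geometric factors of Q ≤ #geometric components of 𝔭, ρ ∈ ℤ[T] ∖ 0 and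
V_j ∈ ℤ[T,U] such that every ℚ̄-zero of Q with ρ ≠ 0 maps by V/ρ into V(S); degrees ≤
(d+2)^(a(m+1)), log₂-weights ≤ (d+2)^(a(m+1))·(log₂ w + log₂ t + 2)^a (Noether position by an
integer linear change, primitive element, arithmetic Bézout for the heights). [difficulty: XL] -/
@[route_item "route-ValiantsHypothesis-LangWeilTransfer"]
def TameResolution : Prop :=
  ∃ a : ℕ, ∀ (m t d w : ℕ) (S : Fin t → MvPolynomial (Fin m) ℤ), (∀ i, (S i).totalDegree ≤ d) → (∀ i, Literature.Computability.AlgebraicComplexity.weight (S i) ≤ w) → ∀ 𝔭 ∈ (Ideal.span (Set.range fun i => MvPolynomial.map (Int.castRingHom ℚ) (S i))).minimalPrimes, ∃ (r : ℕ) (Q : MvPolynomial (Fin (r + 1)) ℤ) (ρ : MvPolynomial (Fin r) ℤ) (V : Fin m → MvPolynomial (Fin (r + 1)) ℤ) (cQ : ℤ), r ≤ m ∧ cQ ≠ 0 ∧ ρ ≠ 0 ∧ (MvPolynomial.finSuccEquiv ℤ r Q).leadingCoeff = MvPolynomial.C cQ ∧ 0 < (MvPolynomial.finSuccEquiv ℤ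 r Q).natDegree ∧ Irreducible (MvPolynomial.map (Int.castRingHom ℚ) Q) ∧ ((Ideal.map (MvPolynomial.map (algebraMap ℚ (AlgebraicClosure ℚ))) (Ideal.span {MvPolynomial.map (Int.castRingHom ℚ) Q})).minimalPrimes).ncard ≤ ((Ideal.map (MvPolynomial.map (algebraMap ℚ (AlgebraicClosure ℚ))) 𝔭).minimalPrimes).ncard ∧ (∀ x : Fin (r + 1) → AlgebraicClosure ℚ, MvPolynomial.aeval x Q = 0 → MvPolynomial.aeval (x ∘ Fin.succ) ρ ≠ 0 → ∀ i, MvPolynomial.aeval (fun j => MvPolynomial.aeval x (V j) / MvPolynomial.aeval (x ∘ Fin.succ) ρ) (S i) = 0) ∧ Q.totalDegree ≤ (d + 2) ^ (a * (m + 1)) ∧ ρ.totalDegree ≤ (d + 2) ^ (a * (m + 1)) ∧ (∀ j, (V j).totalDegree ≤ (d + 2) ^ (a * (m + 1))) ∧ Nat.log 2 (Literature.Computability.AlgebraicComplexity.weight Q) ≤ (d + 2) ^ (a * (m + 1)) * (Nat.log 2 w + Nat.log 2 t + 2) ^ a ∧ Nat.log 2 (Literature.Computability.AlgebraicComplexity.weight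 ρ) ≤ (d + 2) ^ (a * (m + 1)) * (Nat.log 2 w + Nat.log 2 t + 2) ^ a ∧ ∀ j, Nat.log 2 (Literature.Computability.AlgebraicComplexity.weight (V j)) ≤ (d + 2) ^ (a * (m + 1)) * (Nat.log 2 w + Nat.log 2 t + 2) ^ a

-- `TameResolution` holds: proved by `Summit.ValiantsHypothesis.ValiantsHypothesis.Theorems.LangWeilTransfer.tameResolution_proof` (its module imports this route file, so no `_holds` link can be stated here).

/-- item stmt-ValiantsHypothesis-6379 · support · rank 9 · closed · proved by Summit.ValiantsHypothesis.ValiantsHypothesis.Theorems.LangWeilTransfer.transferGlue_proof (prover) · by planner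
sources: Burgisser2000TCS, doi:10.1016/j.ffa.2005.03.003
[support] LangWeilBound → GoodReduction → TameResolution → TameTransfer: pick the tame 𝔭, resolve,
discard the ≤ 2^poly bad primes (content of ρ and cQ, GoodReduction's set), take the first good
prime p > 2^T, the absolutely irreducible factor Q₁ over F_(p^f') (monic in U up to a unit since cQ
is a unit mod p, hence Q₁ ∤ ρ), apply LangWeilBound over GaloisField p (f'μ) with μ minimal, and
clear denominators (pseudo-division by Q only introduces powers of cQ). Bookkeeping of the exponent
a. [difficulty: M] -/
@[route_item "route-ValiantsHypothesis-LangWeilTransfer"]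
def TransferGlue : Prop :=
  LangWeilBound → GoodReduction → TameResolution → TameTransfer

-- `TransferGlue` holds: proved by `Summit.ValiantsHypothesis.ValiantsHypothesis.Theorems.LangWeilTransfer.transferGlue_proof` (its module imports this route file, so no `_holds` link can be stated here).

/-- item stmt-ValiantsHypothesis-6380 · support · rank 9 · closed · proved by Summit.ValiantsHypothesis.ValiantsHypothesis.Theorems.LangWeilTransfer.scalarRestriction_proof (prover) · by planner
sources: Burgisser2000TCS, GathenGerhard2013
[support] Weil restriction of scalars for circuits: a fan-in-two circuit over GaloisField p r
computing (the image of) f ∈ F_p[x] yields a fan-in-two circuit over ZMod p computing f of size ≤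
A(r+1)³(|P|+1) (coordinates in an F_p-basis with e_1 = 1; a product gate costs O(r³) via structure
constants; the first coordinate of the output is f). [difficulty: provable-now] -/
@[route_item "route-ValiantsHypothesis-LangWeilTransfer"]
def ScalarRestriction : Prop :=
  ∃ A : ℕ, ∀ (p : ℕ) [Fact p.Prime] (r : ℕ) (σ : Type) (f : MvPolynomial σ (ZMod p)) (P : Literature.Computability.AlgebraicComplexity.ArithCircuit (GaloisField p r) σ), P.IsFanInTwo → P.Computes (MvPolynomial.map (algebraMap (ZMod p) (GaloisField p r)) f) → ∃ P' : Literature.Computability.AlgebraicComplexity.ArithCircuit (ZMod p) σ, P'.IsFanInTwo ∧ P'.Computes f ∧ P'.size ≤ A * (r + 1) ^ 3 * (P.size + 1)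

-- `ScalarRestriction` holds: proved by `Summit.ValiantsHypothesis.ValiantsHypothesis.Theorems.LangWeilTransfer.scalarRestriction_proof` (its module imports this route file, so no `_holds` link can be stated here).

/-- item stmt-ValiantsHypothesis-6381 · support · rank 9 · open · by planner
sources: KarpLipton1980, Burgisser2000TCS
[support] P^#P ⊄ P/poly — the Boolean conjunct; implied by NP ⊄ P/poly (stmt-PneNP-0260,
`NPNotSubsetPPoly`, via `NP_subset_PSharpP_holds`); filed for bookkeeping/dedup with the PneNP tree,
not expected to receive prover time here. [difficulty: open-problem] -/
@[route_item "route-ValiantsHypothesis-LangWeilTransfer"]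
def SharpPNotPPoly : Prop :=
  ¬ (Literature.Computability.Complexity.PSharpP ⊆ Literature.Computability.Complexity.PPoly)

/-- item stmt-ValiantsHypothesis-6382 · assembly · rank 1 · closed · proved by Summit.ValiantsHypothesis.ValiantsHypothesis.Theorems.LangWeilTransfer.assembly_proof (prover) · by planner
sources: Burgisser2000TCS, Burgisser2006, KarpLipton1980
[assembly] ShatteringExclusion → TameTransfer → ScalarRestriction → SharpPNotPPoly →
ValiantsHypothesis. -/
@[route_item "route-ValiantsHypothesis-LangWeilTransfer"]
def Assembly : Prop :=
  ShatteringExclusion → TameTransfer → ScalarRestriction → SharpPNotPPoly → ValiantsHypothesis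

-- `Assembly` holds: proved by `Summit.ValiantsHypothesis.ValiantsHypothesis.Theorems.LangWeilTransfer.assembly_proof` (its module imports this route file, so no `_holds` link can be stated here).

/-! D-0027 §2.1 — DECIDING THEOREM (planner-authored via `route open/edit --closes-file`; by planner-rbadge-ValiantsHypothesis-LangWeilTran-c125a777-g2-0 2026-08-15T16:10:47Z):
its hypotheses are this route's items and its conclusion the sub-problem Statement (glue_lint), and it elaborates with this file. -/

@[closes "route-ValiantsHypothesis-LangWeilTransfer"] theorem closes (h_ShatteringExclusion : ShatteringExclusion) (h_TameTransfer : TameTransfer)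
    (h_ScalarRestriction : ScalarRestriction) (h_SharpPNotPPoly : SharpPNotPPoly)
    (h_Assembly : Assembly) : _root_.ValiantsHypothesis :=
  h_Assembly h_ShatteringExclusion h_TameTransfer h_ScalarRestriction h_SharpPNotPPoly

end Summit.ValiantsHypothesis.ValiantsHypothesis.Theses.LangWeilTransfer
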